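import Literature.Analysis.ValidatedNumerics.BoxCover
import HarnessLib

/-!
# Box infeasibility certificates: a polynomial system has no real solution in a box

Topic `Literature/Analysis/ValidatedNumerics` (companion of `BoxCover.lean`).  The second standard
use of interval evaluation with subdivision (Moore 1966, §4.4; the "exclusion test" of interval
branch-and-bound): a SYSTEM of polynomial constraints `g₁ ≥ 0, …, g_m ≥ 0, h₁ = 0, …, h_n = 0` in the
coordinates of a rational box has NO real solution in the box if the box can be subdivided into
cells on each of which some `g_i` has a negative enclosure or some `h_j` has an enclosure not
containing `0`.  With `KdCert` (kd-trees of working precisions) as certificates: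

* `infeasLeaf gs hs B prec` — the exclusion test on one box, `infeasLeaf_sound`;
* `InfeasClaim` (`gs`, `hs`, `box`), `InfeasClaim.Holds` (no point of the box satisfies all
  constraints), the verifier `kdInfeasVerifier`, `InfeasClaim.holds_of_check`;
* kernel example: `x² + y² = 1`, `x ≥ 4/5`, `y ≥ 4/5` has no solution in `[0,1]²` (one bisection
  per axis).

This is the certificate format of the polygon/cluster lemmas of the robust kissing classification
(`Summits/AtomisticToContinuum/…/TwoCentreKissingKernelRobustTangencyBound*`): there the variables
are inner products and the cosines/sines of corner angles, and the constraints are the algebraic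
corner relations and vertex conditions.
-/

namespace Literature.Analysis.ValidatedNumerics

open NonemptyInterval

/-- **Exclusion test on a box**: some inequality constraint `g ≥ 0` has the right end of its
enclosure `< 0`, or some equation `h = 0` has an enclosure on one side of `0`.
[cite: Moore1966, Theorem 3.1, §4.4] -/
def infeasLeaf (gs hs : List ArithExpr) (B : Box) (prec : ℕ) : Bool :=
  gs.any (fun g => decide ((g.enclose prec B.toIvl).snd < 0)) ||
    hs.any (fun h => decide ((h.enclose prec B.toIvl).snd < 0) ||
      decide (0 < (h.enclose prec B.toIvl).fst))

/-- **Soundness of the exclusion test**: an accepted box contains no point satisfying all the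
constraints. [cite: Moore1966, Theorem 3.1] -/
theorem infeasLeaf_sound {gs hs : List ArithExpr} {B : Box} {prec : ℕ}
    (h : infeasLeaf gs hs B prec = true) (x : ℕ → ℝ) (hx : B.mem x) :
    ¬ ((∀ g ∈ gs, 0 ≤ g.eval x) ∧ (∀ e ∈ hs, e.eval x = 0)) := by
  rintro ⟨hg, he⟩
  have hmem := fun e : ArithExpr => ArithExpr.eval_mem_enclose (prec := prec) (Box.mem_toIvl hx) e
  rw [infeasLeaf, Bool.or_eq_true, List.any_eq_true, List.any_eq_true] at h
  rcases h with ⟨g, hgm, hlt⟩ | ⟨e, hem, hlt⟩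
  · have h1 := (mem_ratCast_iff.1 (hmem g)).2
    have h2 : (((g.enclose prec B.toIvl).snd : ℚ) : ℝ) < 0 := by
      exact_mod_cast of_decide_eq_true hlt
    linarith [hg g hgm]
  · have h1 := mem_ratCast_iff.1 (hmem e)
    rw [he e hem] at h1
    rw [Bool.or_eq_true] at hlt
    rcases hlt with hlt | hlt
    · have h2 : (((e.enclose prec B.toIvl).snd : ℚ) : ℝ) < 0 := by
        exact_mod_cast of_decide_eq_true hlt
      linarith [h1.2]
    · have h2 : (0 : ℝ) < ((e.enclose prec B.toIvl).fst : ℚ) := by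
        exact_mod_cast of_decide_eq_true hlt
      linarith [h1.1]

/-- **No solution in a box, from a kd-tree of precisions.** [cite: Moore1966, Theorem 3.1, §4.4] -/
theorem not_sol_of_kdCheck {gs hs : List ArithExpr} {B : Box} {t : KdCert ℕ}
    (h : t.check (infeasLeaf gs hs) B = true) (x : ℕ → ℝ) (hx : B.mem x) :
    ¬ ((∀ g ∈ gs, 0 ≤ g.eval x) ∧ (∀ e ∈ hs, e.eval x = 0)) :=
  KdCert.sound (P := fun x => ¬ ((∀ g ∈ gs, 0 ≤ g.eval x) ∧ (∀ e ∈ hs, e.eval x = 0)))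
    (fun _ _ hl x hx ↦ infeasLeaf_sound hl x hx) t B h x hx

/-- An **infeasibility claim**: the system `g ≥ 0 (g ∈ gs)`, `h = 0 (h ∈ hs)` has no real solution
in the rational box `box`. [folklore] -/
structure InfeasClaim where
  /-- the inequality constraints `g ≥ 0` -/
  gs : List ArithExpr
  /-- the equality constraints `h = 0` -/
  hs : List ArithExpr
  /-- the box -/
  box : Box

/-- The proposition asserted by an infeasibility claim. [folklore] -/
def InfeasClaim.Holds (c : InfeasClaim) : Prop :=
  ∀ x : ℕ → ℝ, c.box.mem x → ¬ ((∀ g ∈ c.gs, 0 ≤ g.eval x) ∧ (∀ e ∈ c.hs, e.eval x = 0))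

/-- **The subdividing infeasibility verifier**: certificates are kd-trees whose leaves carry
working precisions; the checker runs the exclusion test on every leaf box.
[cite: Moore1966, Theorem 3.1, §4.4] -/
def kdInfeasVerifier : Verifier InfeasClaim InfeasClaim.Holds where
  Cert := KdCert ℕ
  check c t := t.check (infeasLeaf c.gs c.hs) c.box
  sound _ _ h x hx := not_sol_of_kdCheck h x hx

/-- The checker of `kdInfeasVerifier`, unfolded. [folklore] -/
@[simp] theorem kdInfeasVerifier_check (c : InfeasClaim) (t : KdCert ℕ) :
    kdInfeasVerifier.check c t = t.check (infeasLeaf c.gs c.hs) c.box := rfl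

/-- **Soundness of the infeasibility verifier** in the statement shape of `Certificate.lean`.
[cite: Moore1966, Theorem 3.1, §4.4] -/
theorem InfeasClaim.holds_of_check (c : InfeasClaim) (t : KdCert ℕ)
    (h : kdInfeasVerifier.check c t = true) : c.Holds :=
  kdInfeasVerifier.claim t h

/-- Kernel example: `x² + y² − 1 = 0`, `x − 4/5 ≥ 0`, `y − 4/5 ≥ 0` has no solution in `[0,1]²`.
On the whole box the enclosure of `x² + y² − 1` is `[−1, 1] ∋ 0` and those of `x − 4/5`, `y − 4/5`
reach `1/5 ≥ 0`, so the one-box test fails; after bisecting both axes at `79/100` every cell is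
excluded (`x − 4/5 ≤ −1/100`, or `y − 4/5 ≤ −1/100`, or `x² + y² − 1 ≥ 0.248 > 0`). -/
example : InfeasClaim.Holds
    ⟨[.sub (.var 0) (.const (4/5)), .sub (.var 1) (.const (4/5))],
     [.sub (.add (.mul (.var 0) (.var 0)) (.mul (.var 1) (.var 1))) (.const 1)],
     [(0, 1), (0, 1)]⟩ :=
  InfeasClaim.holds_of_check _
    (.split 0 (79/100) (.leaf 8) (.split 1 (79/100) (.leaf 8) (.leaf 8))) (by decide +kernel)

end Literature.Analysis.ValidatedNumerics
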